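import Literature.AlgebraicGeometry.Resolution.QuadraticTransformsKeyLemma
import Mathlib.AlgebraicGeometry.GammaSpecAdjunction
import HarnessLib

/-!
# A regular system of parameters of a two-dimensional regular local ring, read on `Γ(Spec T, 𝒪)`

Topic: `Literature/AlgebraicGeometry/Resolution`. Brick (S0) of the sub-cell «(1.2) 2-reg» of the D-0154 (2)
RES inputs cell (planner skeleton `F79_2reg_BRICKS_SKELETON.lean`, `stub_rsop_chart`): for a two-dimensional
regular local ring `T`, the maximal ideal, transported to `Γ(Spec T, ⊤)` along `Scheme.ΓSpecIso`, is generated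
by two elements `u, v` forming a regular pair IN BOTH ORDERS (`u`, `v` nonzerodivisors, `u ∣ r v ⇒ u ∣ r`,
`v ∣ r u ⇒ v ∣ r`) — the input format of the two-chart computation
`IsBlowup.hasTrivialCechH1_of_ideal_eq_span_pair` (`TwoChartBlowupCechH1.lean`; Lipman 1969, proof of
Prop. (1.2) A), p. 200: "`x` corresponds to a maximal ideal in `T` generated by two elements, say `b` and
`c`"). Source of the pair: `exists_maximalIdeal_eq_span_pair` (`𝔪 = (x, y)` with `x`, `y` non-associate
prime elements of the UFD `T`). No definitions, no named facts; nothing about (1.2) itself is proved here.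

## Sources

* J. Lipman, Publ. Math. IHÉS 36 (1969), proof of Prop. (1.2), statement A), p. 200. [Lipman1969]
* H. Matsumura, *Commutative Ring Theory* (1986), Thm. 14.2, Thm. 20.3 (regular local rings are UFDs). [Matsumura1987]
-/

noncomputable section

open CategoryTheory AlgebraicGeometry IsLocalRing

namespace Literature.AlgebraicGeometry.Resolution

universe u

/-- **`𝔪_T = (u, v)` on `Γ(Spec T, 𝒪)` with `(u, v)`, `(v, u)` regular pairs**, for `T` a regular local
ring of dimension two: transport of `exists_maximalIdeal_eq_span_pair` (`𝔪 = (x, y)`, `x`, `y` prime,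
`x ∤ y`, `y ∤ x`) along `Γ(Spec T, ⊤) ≅ T`. [cite: Matsumura1987, Thm. 14.2]
[cite: Lipman1969, Proposition (1.2), proof of statement A) (p. 200)] -/
theorem exists_map_maximalIdeal_ΓSpec_eq_span_regularPair {T : Type u} [CommRing T]
    [IsRegularLocalRing T] (hT : ringKrullDim T = 2) :
    ∃ u v : Γ(Spec (.of T), ⊤),
      Ideal.map (Scheme.ΓSpecIso (.of T)).inv.hom (maximalIdeal T) = Ideal.span {u, v} ∧
      u ∈ nonZeroDivisors Γ(Spec (.of T), ⊤) ∧ (∀ r, u ∣ r * v → u ∣ r) ∧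
      v ∈ nonZeroDivisors Γ(Spec (.of T), ⊤) ∧ (∀ r, v ∣ r * u → v ∣ r) := by
  haveI := isDomain_of_isRegularLocalRing T
  obtain ⟨x, y, hm, hx, hy, hxy, hyx⟩ := exists_maximalIdeal_eq_span_pair (R := T) hT
  let e : T ≃+* Γ(Spec (.of T), ⊤) := (Scheme.ΓSpecIso (.of T)).commRingCatIsoToRingEquiv.symm
  have he : ∀ t, (Scheme.ΓSpecIso (.of T)).inv.hom t = e t := fun _ => rfl
  haveI : IsDomain Γ(Spec (.of T), ⊤) := e.symm.injective.isDomain e.symm.toRingHom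
  have hdvd : ∀ {a b : T}, Prime a → ¬ a ∣ b → ∀ r : Γ(Spec (.of T), ⊤), e a ∣ r * e b → e a ∣ r := by
    intro a b ha hab r hr
    obtain ⟨t, rfl⟩ := e.surjective r
    rw [← map_mul, map_dvd_iff] at hr
    rw [map_dvd_iff]
    exact (ha.dvd_or_dvd hr).resolve_right hab
  refine ⟨e x, e y, ?_, ?_, hdvd hx hxy, ?_, hdvd hy hyx⟩
  · rw [hm, Ideal.map_span, Set.image_pair, he, he]
  · exact mem_nonZeroDivisors_of_ne_zero ((map_ne_zero_iff e e.injective).mpr hx.ne_zero)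
  · exact mem_nonZeroDivisors_of_ne_zero ((map_ne_zero_iff e e.injective).mpr hy.ne_zero)

end Literature.AlgebraicGeometry.Resolution

end
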